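import Summits.NavierStokesRegularity.NavierStokesRegularity.Theorems.HodographBetchovFastClassSqueezeNoConcentration

/-!
# Skeleton (BC3) for piece X₂ `FastGradientSerrinStarved` (stmt-NavierStokesRegularity-18120) of the split of
# `FastClassSqueeze` (stmt-NavierStokesRegularity-15832, route `HodographBetchov`) — line `critical-starvation`

The piece, verbatim `Summit.NavierStokesRegularity.NavierStokesRegularity.Theses.HodographBetchov.FastGradientSerrinStarved`
(route leaf stmt-18120 = the vetted stub `stub_fast_gradient_serrin_of_no_concentration` of `Cruxes/FastClassSqueeze/Lines/birth.lean`): along every classical solution `(u,p)` of unforced Navier–Stokes on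
`ℝ³ × [0,T)` that is Leray–Hopf from a rapidly decaying datum, IF the kinetic energy is uniformly integrable over
speed classes up to `T` (`∀ ε ∃ l ∀ t : ∫_{|u(t)|>l} |u(t)|² ≤ ε`, the conclusion of piece X₁) THEN for some level
`l > 0` and exponent `q > 3/2` the fast-class GRADIENT is Miller–Serrin finite,
`∫₀ᵀ (∫_{|u(t)|>l} ‖∇u(t,x)‖^q dx)^{2/(2q−3)} dt < ∞`.

## The line: starvation at the CRITICAL rate along a sequence of levels + ε-regularity at infinite speed

Why this cut. X₁ hands over `U(l) := sup_{t<T} ∫ (|u(t)|−l)₊² + ν ∫₀ᵀ∫_{|u|>l} ‖∇u‖² = o(1)` as `l → ∞`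
(the first term by hypothesis, the second for free by monotone convergence from `ν∫∫‖∇u‖² ≤ E₀`). A speed-level
De Giorgi truncation `v_k = (|u| − l_k)₊`, `l_k ↑ K l` (Vasseur 2007; Caffarelli–Vasseur 2010 §3) is COLLAR-FREE —
the transport term integrates to zero over every velocity class, exactly the route's theme — but, like every
ε-regularity statement, it is SCALE-INVARIANT: the only dimensionless smallness is `l · U(l) / ν³` (energy above
speed `l` measured in units of the energy `l² (ν/l)³` of ONE Kolmogorov cell at speed `l`). So the honest content of
the piece splits into (i) an A-PRIORI statement upgrading X₁'s `o(1)` to the critical rate `U(l) ≤ ε ν³ / l` along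
SOME sequence of levels, and (ii) a CONDITIONAL-REGULARITY statement at that rate. Both are open; (ii) is the one a
prover can attack today.

* `stub_critical_starvation` — **AN ENERGY-STARVED FAST CLASS STARVES AT THE CRITICAL RATE ALONG A SEQUENCE OF
  LEVELS (open, a-priori, critical — the hard core).** Along every such flow whose energy is uniformly integrable
  over speed classes: for every `ε > 0` and every `l₀` there is a level `l ≥ l₀`, `l > 0`, with
  `sup_{t<T} ∫_{|u|>l} (|u(t)|−l)² ≤ ε ν³/l` and `ν ∫₀ᵀ ∫_{|u|>l} ‖∇u‖² ≤ ε ν³/l`, i.e. `liminf_{l→∞} l·U(l)/ν³ = 0`.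
  Why it might fail / strength: a self-similar-rate (Type I) collapse has `∫_{|u|>l}|u|² ≍ C³/l`, so
  `l·U(l) → C³ > 0` — the stub FAILS for a Type-I blow-up with a large constant, exactly as the parent piece does
  (its Serrin norm is log-divergent there): this stub, not X₁, carries the regularity-strength of the crux. It is
  where the dynamics must enter (the fast-class energy balance `d/dt ∫ v_l²/2 = −ν ∫ d_l² +` pressure work through
  the isotach `{|u| = l}`).
* `stub_speed_epsilon_regularity` — **ε-REGULARITY AT INFINITE SPEED (open CONDITIONAL regularity, scale-invariant,
  collar-free; the provable-looking half).** There are universal `ε₀ > 0`, `K` and `c` such that along every such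
  flow and every level `l > 0`: if `sup_{t<T} ∫_{|u|>l} (|u(t)|−l)² ≤ ε₀ ν³/l` and `ν ∫₀ᵀ∫_{|u|>l} ‖∇u‖² ≤ ε₀ ν³/l`
  then `|u(t,x)| ≤ K l` for all `x` and all `t ∈ [0,T)` past the viscous lag, `c ν ≤ t l²`. Sanity checks passed
  by hand: small `l` (hypothesis then forces `E₀ l/ν³ ≲ ε₀`, a Reynolds-number-one regime where heat smoothing gives
  `|u(ν/l²)| ≲ l (E₀l/ν³)^{1/2} ≤ ε₀^{1/2} l`); a super-fast blob above `2l` compatible with the hypothesis has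
  Kolmogorov size `ε₀^{1/3} ν/l` and lifetime `ε₀^{2/3} ν/l²`. Two attacks: the speed-level De Giorgi recurrence
  (superlinear in `U_{k−1}` for the fast self-interaction pressure `R_iR_j(u_iu_j 1_{|u|>l})`; the SLOW pressure
  `R_iR_j(u_iu_j 1_{|u|≤l})`, bounded source of size `l²`, enters (sub)linearly unless its near field is resolved at
  the collar — the known obstruction, Caffarelli–Vasseur 2010 §3), and perturbative local regularity around the
  truncated field `u·min(1, l/|u|)` at its own Kolmogorov scale `ν/l` (Reynolds number one, Serrin `L^∞` local
  theory — the route's DeepSlowGradient regime). Why it might fail: nonlocal acceleration of a Kolmogorov-size blob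
  by energetic SLOW surroundings through a fat collar (the same collar that is crux SlowClassProduction's content).
  Nearest print: small-`L^∞_t L^{3,∞}_x` regularity (Kozono 1998; Kim–Kozono 2006; Luo–Tsai), which assumes the
  weak-`L³` smallness at EVERY level — here one level and one-sided truncations only.

Assembly `FastGradientSerrinStarved_of` (kernel-checked below; no `sorry` outside the two stubs): given the flow and
X₁'s conclusion, take `ε₀, K, c` from stub 2 and from stub 1 a level `l ≥ max 1 (2cν/T)` starving at rate `ε₀`;
stub 2 bounds `|u| ≤ K l` on `[T/2, T)` (the lag `cν ≤ t l²` holds there), the landed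
`Birth.exists_forall_norm_le_on_closedSlab` bounds `|u| ≤ M` on `[0, T/2]`; so `|u| ≤ L := max M (K l)` on `[0,T)`
and the fast class of level `max L 0 + 1` is EMPTY: the Serrin integral vanishes (`q = 2`). The line therefore
proves MORE than the piece (boundedness up to `T` for energy-starved flows) — as every known road to an a-priori
Serrin bound does; a NON-vacuous fast-class Serrin bound along a genuine blow-up would put the whole Serrin
divergence into the slow class, i.e. into the collar, which is crux SlowClassProduction's territory, not this piece's.

Disproof used: `Theorems/FastClassSqueeze/Negative/FalseWithoutLerayHopf.lean`
(`fastClassSqueeze_false_without_lerayHopf`, on the PARENT): honoured — both stubs carry `IsLerayHopfOn`; stub 1 is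
false without the energy class for the same biaxial-strain witness (infinite-volume fast class), stub 2's smallness
hypothesis is an energy-class quantity. No `Disproof.lean` is filed for the crux. Sorries: exactly the two `stub_*`.
References: Vasseur, NoDEA 14 (2007) 753–785; Caffarelli–Vasseur, DCDS-S 3 (2010) 409–427 §3
[doi:10.3934/dcdss.2010.3.409]; Beirão da Veiga, Chin. Ann. Math. B 16 (1995) 407; Miller2019 (arXiv:1710.05569);
Kozono, Tohoku Math. J. 50 (1998); Leslie–Shvydkoy arXiv:1705.04420 (Type-I energy scaling `∫_{B_r}|u|² ≍ r`).
-/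

set_option linter.dupNamespace false

namespace Summit.NavierStokesRegularity.NavierStokesRegularity.Cruxes.FastGradientSerrinStarved.CriticalStarvation

open MeasureTheory Set
open Summit.NavierStokesRegularity.NavierStokesRegularity.Theorems.FastClassSqueeze

/-- **Stub 1 — an energy-starved fast class starves at the CRITICAL rate along a sequence of levels (OPEN,
a-priori, critical; the hard core).** Along every classical Leray–Hopf flow from a rapidly decaying datum on
`[0,T)` whose kinetic energy is uniformly integrable over speed classes: for every `ε > 0` and every `l₀` there is
a level `l ≥ l₀`, `l > 0`, at which the truncated energy `sup_{t<T} ∫_{|u|>l} (|u(t,x)| − l)² dx` and the fast-class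
dissipation `ν ∫₀ᵀ ∫_{|u|>l} ‖∇u‖² dx dt` are both `≤ ε ν³ / l` (`liminf_{l → ∞} l·U(l)/ν³ = 0`). -/
theorem stub_critical_starvation :
    ∀ (ν T : ℝ), 0 < ν → 0 < T →
      ∀ (u : ℝ → EuclideanSpace ℝ (Fin 3) → EuclideanSpace ℝ (Fin 3)) (p : ℝ → EuclideanSpace ℝ (Fin 3) → ℝ),
      Literature.Analysis.FluidPDE.IsClassicalNSSolutionOn (Set.Ico 0 T) ν 0 u p →
      Literature.Analysis.FluidPDE.IsLerayHopfOn T ν 0 (u 0) u →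
      Literature.Analysis.FluidPDE.HasRapidSpatialDecay (u 0) →
      (∀ ε : ℝ, 0 < ε → ∃ l : ℝ, 0 < l ∧ ∀ t ∈ Set.Ico 0 T,
        ∫⁻ x in {x : EuclideanSpace ℝ (Fin 3) | l < ‖u t x‖}, ‖u t x‖ₑ ^ 2 ≤ ENNReal.ofReal ε) →
      ∀ ε : ℝ, 0 < ε → ∀ l₀ : ℝ, ∃ l : ℝ, l₀ ≤ l ∧ 0 < l ∧
        (∀ t ∈ Set.Ico 0 T, ∫⁻ x in {x : EuclideanSpace ℝ (Fin 3) | l < ‖u t x‖},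
          ENNReal.ofReal ((‖u t x‖ - l) ^ 2) ≤ ENNReal.ofReal (ε * ν ^ 3 / l)) ∧
        ENNReal.ofReal ν * ∫⁻ t in Set.Ioo 0 T, ∫⁻ x in {x : EuclideanSpace ℝ (Fin 3) | l < ‖u t x‖},
          ‖fderiv ℝ (u t) x‖ₑ ^ 2 ≤ ENNReal.ofReal (ε * ν ^ 3 / l) := by
  sorry

/-- **Stub 2 — ε-regularity at infinite speed (OPEN conditional regularity; scale-invariant, collar-free).**
There are universal constants `ε₀ > 0`, `K`, `c` such that for every classical Leray–Hopf flow from a rapidly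
decaying datum on `[0,T)` and every level `l > 0`: if the truncated energy `sup_{t<T} ∫_{|u|>l} (|u(t)|−l)²` and the
fast-class dissipation `ν∫₀ᵀ∫_{|u|>l} ‖∇u‖²` are both `≤ ε₀ ν³/l`, then `|u(t,x)| ≤ K l` for every `x` and every
`t ∈ [0,T)` past the viscous lag `c ν ≤ t l²` (speed-level De Giorgi, Vasseur 2007 / Caffarelli–Vasseur 2010 §3,
with no spatial cut-off; or local Serrin `L^∞` theory around the truncated field at its Kolmogorov scale `ν/l`). -/
theorem stub_speed_epsilon_regularity :
    ∃ ε₀ : ℝ, 0 < ε₀ ∧ ∃ K c : ℝ, ∀ (ν T : ℝ), 0 < ν → 0 < T →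
      ∀ (u : ℝ → EuclideanSpace ℝ (Fin 3) → EuclideanSpace ℝ (Fin 3)) (p : ℝ → EuclideanSpace ℝ (Fin 3) → ℝ),
      Literature.Analysis.FluidPDE.IsClassicalNSSolutionOn (Set.Ico 0 T) ν 0 u p →
      Literature.Analysis.FluidPDE.IsLerayHopfOn T ν 0 (u 0) u →
      Literature.Analysis.FluidPDE.HasRapidSpatialDecay (u 0) →
      ∀ l : ℝ, 0 < l →
        (∀ t ∈ Set.Ico 0 T, ∫⁻ x in {x : EuclideanSpace ℝ (Fin 3) | l < ‖u t x‖},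
          ENNReal.ofReal ((‖u t x‖ - l) ^ 2) ≤ ENNReal.ofReal (ε₀ * ν ^ 3 / l)) →
        ENNReal.ofReal ν * ∫⁻ t in Set.Ioo 0 T, ∫⁻ x in {x : EuclideanSpace ℝ (Fin 3) | l < ‖u t x‖},
          ‖fderiv ℝ (u t) x‖ₑ ^ 2 ≤ ENNReal.ofReal (ε₀ * ν ^ 3 / l) →
        ∀ t ∈ Set.Ico 0 T, c * ν ≤ t * l ^ 2 → ∀ x, ‖u t x‖ ≤ K * l := by
  sorry

/-- **Assembly: the piece BY NAME from the two registered stubs BY NAME** (kernel-checked; no direct `sorry`).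
Stub 2 supplies `ε₀, K, c`; stub 1 (fed with X₁'s conclusion) a level `l ≥ max 1 (2cν/T)` starving at rate `ε₀`,
so the lag `cν ≤ t l²` holds on `[T/2, T)` and stub 2 bounds `|u| ≤ K l` there; the landed early-slab bound
`Birth.exists_forall_norm_le_on_closedSlab` covers `[0, T/2]`; a bounded flow has an EMPTY fast class one unit
above its bound, where the Serrin integral vanishes (`q = 2`). -/
theorem FastGradientSerrinStarved_of :
    Summit.NavierStokesRegularity.NavierStokesRegularity.Theses.HodographBetchov.FastGradientSerrinStarved := by
  intro ν T hν hT u p hcl hLH hdec hE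
  obtain ⟨ε₀, hε₀, K, c, hreg⟩ := stub_speed_epsilon_regularity
  obtain ⟨l, hl₀, hl, hsup, hdiss⟩ :=
    stub_critical_starvation ν T hν hT u p hcl hLH hdec hE ε₀ hε₀ (max 1 (2 * c * ν / T))
  have hl1 : 1 ≤ l := le_trans (le_max_left _ _) hl₀
  have hlc : 2 * c * ν / T ≤ l := le_trans (le_max_right _ _) hl₀
  have hlT : 2 * c * ν ≤ l * T := by
    have := (div_le_iff₀ hT).1 hlc
    linarith
  -- late times `[T/2, T)`: the lag holds, stub 2 bounds the speed by `K l`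
  have hlate : ∀ t ∈ Ico 0 T, T / 2 ≤ t → ∀ x, ‖u t x‖ ≤ K * l := by
    intro t ht htT x
    refine hreg ν T hν hT u p hcl hLH hdec l hl hsup hdiss t ht ?_ x
    by_cases hc : c ≤ 0
    · have h1 : c * ν ≤ 0 := mul_nonpos_of_nonpos_of_nonneg hc hν.le
      have h2 : 0 ≤ t * l ^ 2 := by have := ht.1; positivity
      linarith
    · push Not at hc
      have hl2 : l ≤ l ^ 2 := by nlinarith
      have h3 : c * ν ≤ (T / 2) * l := by nlinarith
      have h4 : (T / 2) * l ≤ t * l := mul_le_mul_of_nonneg_right htT hl.le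
      have h5 : t * l ≤ t * l ^ 2 := mul_le_mul_of_nonneg_left hl2 ht.1
      linarith
  -- early times `[0, T/2]`: the landed closed-slab bound
  obtain ⟨M, hM⟩ := Birth.exists_forall_norm_le_on_closedSlab hν hcl hLH hdec (half_pos hT) (half_lt_self hT)
  -- a uniform bound on `[0,T)`
  have hbound : ∀ t ∈ Ico 0 T, ∀ x, ‖u t x‖ ≤ max M (K * l) := by
    intro t ht x
    by_cases htT : t ≤ T / 2
    · exact (hM t ⟨ht.1, htT⟩ x).trans (le_max_left _ _)
    · push Not at htT
      exact (hlate t ht htT.le x).trans (le_max_right _ _)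
  -- the fast class one unit above the bound is empty: the Serrin integral vanishes
  refine ⟨max (max M (K * l)) 0 + 1, by positivity, 2, by norm_num, ?_⟩
  have hempty : ∀ t ∈ Ioo 0 T,
      {x : EuclideanSpace ℝ (Fin 3) | max (max M (K * l)) 0 + 1 < ‖u t x‖} = ∅ := by
    intro t ht
    ext x
    simp only [Set.mem_setOf_eq, Set.mem_empty_iff_false, iff_false, not_lt]
    have hx := hbound t ⟨ht.1.le, ht.2⟩ x
    linarith [le_max_left (max M (K * l)) 0]
  have hzero : ∀ t ∈ Ioo 0 T,
      (∫⁻ x in {x : EuclideanSpace ℝ (Fin 3) | max (max M (K * l)) 0 + 1 < ‖u t x‖},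
        ENNReal.ofReal ‖fderiv ℝ (u t) x‖ ^ (2 : ℝ)) ^ (2 / (2 * 2 - 3) : ℝ) = 0 := by
    intro t ht
    rw [hempty t ht, setLIntegral_empty]
    exact ENNReal.zero_rpow_of_pos (by norm_num)
  rw [setLIntegral_congr_fun measurableSet_Ioo hzero]
  simp

end Summit.NavierStokesRegularity.NavierStokesRegularity.Cruxes.FastGradientSerrinStarved.CriticalStarvation
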